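import Summits.MatrixMultiplication.MatrixMultiplication.Theses.IntegralSignedBoxes

/-!
# Birth skeleton (BC3) for the crux `ModularExponentTwo` — "ω(𝔽_p) = 2 for every prime p"

Line `large-then-down` (regime decomposition along the primes):
* `stub_largeCharacteristicFast` — matrix multiplication is asymptotically fast in LARGE
  characteristic: `limsup_p ω(𝔽_p) = 2` (for every ε > 0, every prime `p ≥ p₀(ε)` has a witness
  `R_{𝔽_p}(⟨n,n,n⟩) ≤ n^{2+ε}`, `n ≥ 2`).  The prime-field form of the crux
  `CharacteristicContinuity.LargeCharacteristicFast` (`ω(F̄_p) ≤ 2 + ε` for large `p`), itself the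
  weakest unknown consequence of `ω(ℂ) = 2` (Lefschetz, planner-proved `W_of_S`).
* `stub_characteristicUniformity` — NO prime is harder than the generic large prime:
  `ω(𝔽_p) ≤ limsup_ℓ ω(𝔽_ℓ)` for every prime `p` (downward transfer between characteristics; the
  residue-field shadow of Pan's 1984 problems (i)+(ii), `ω_{ℤ/p} = ω_ℤ = ω_ℚ`).
`ModularExponentTwo_of` composes them prime by prime.  Sorries live ONLY in the two stubs.
-/

set_option linter.dupNamespace false

namespace Summit.MatrixMultiplication.MatrixMultiplication.Cruxes.ModularExponentTwo.LargeThenDown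

open Literature.Computability.AlgebraicComplexity

/-! The crux is the route decl `Summit.MatrixMultiplication.MatrixMultiplication.Theses.IntegralSignedBoxes.ModularExponentTwo`
(route rev 2), used BY NAME. -/
open Summit.MatrixMultiplication.MatrixMultiplication.Theses.IntegralSignedBoxes (ModularExponentTwo)

/-- STUB — `limsup_p ω(𝔽_p) = 2` in rank form. -/
theorem stub_largeCharacteristicFast :
    ∀ ε : ℝ, 0 < ε → ∃ p₀ : ℕ, ∀ p : ℕ, p.Prime → p₀ ≤ p → ∃ n : ℕ, 2 ≤ n ∧
      (tensorRank (matMulTensor (ZMod p) n n n) : ℝ) ≤ (n : ℝ) ^ (2 + ε) := by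
  sorry

/-- STUB — downward uniformity `ω(𝔽_p) ≤ limsup_ℓ ω(𝔽_ℓ)` for every prime `p`, rank form. -/
theorem stub_characteristicUniformity :
    ∀ p : ℕ, p.Prime → ∀ τ : ℝ,
      (∀ ε : ℝ, 0 < ε → ∃ p₀ : ℕ, ∀ ℓ : ℕ, ℓ.Prime → p₀ ≤ ℓ → ∃ n : ℕ, 2 ≤ n ∧
        (tensorRank (matMulTensor (ZMod ℓ) n n n) : ℝ) ≤ (n : ℝ) ^ (τ + ε)) →
      ∀ ε : ℝ, 0 < ε → ∃ n : ℕ, 2 ≤ n ∧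
        (tensorRank (matMulTensor (ZMod p) n n n) : ℝ) ≤ (n : ℝ) ^ (τ + ε) := by
  sorry

/-- Composition: large characteristic + downward uniformity ⇒ `ω(𝔽_p) = 2` for every prime. -/
theorem ModularExponentTwo_of :
    (∀ ε : ℝ, 0 < ε → ∃ p₀ : ℕ, ∀ p : ℕ, p.Prime → p₀ ≤ p → ∃ n : ℕ, 2 ≤ n ∧
      (tensorRank (matMulTensor (ZMod p) n n n) : ℝ) ≤ (n : ℝ) ^ (2 + ε)) →
    (∀ p : ℕ, p.Prime → ∀ τ : ℝ,
      (∀ ε : ℝ, 0 < ε → ∃ p₀ : ℕ, ∀ ℓ : ℕ, ℓ.Prime → p₀ ≤ ℓ → ∃ n : ℕ, 2 ≤ n ∧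
        (tensorRank (matMulTensor (ZMod ℓ) n n n) : ℝ) ≤ (n : ℝ) ^ (τ + ε)) →
      ∀ ε : ℝ, 0 < ε → ∃ n : ℕ, 2 ≤ n ∧
        (tensorRank (matMulTensor (ZMod p) n n n) : ℝ) ≤ (n : ℝ) ^ (τ + ε)) →
    ModularExponentTwo := by
  intro hL hU p hp ε hε
  exact hU p hp 2 hL ε hε

/-- The skeleton concludes the crux from the two stubs. -/
theorem ModularExponentTwo_of_stubs : ModularExponentTwo :=
  ModularExponentTwo_of stub_largeCharacteristicFast stub_characteristicUniformity

end Summit.MatrixMultiplication.MatrixMultiplication.Cruxes.ModularExponentTwo.LargeThenDown
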